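import Mathlib.MeasureTheory.Integral.IntervalIntegral.FundThmCalculus
import Mathlib.MeasureTheory.Integral.IntervalIntegral.IntegrationByParts
import HarnessLib

/-!
# Stub `stub_taylorSuper` — from an integrated second-derivative inequality to the
integral supersolution inequality
(crux `LeeYang.LeeyangThesis`, line Sketch, card telegraph-string; calibration sub-programme,
RH-free real analysis)

Let `ρ, g, g'` be continuous on `[0, L)`, `ρ ≥ 0`, `g ≥ 0`, `g(0) ≥ 1`, `g'(0) ≥ 0`, `g' = dg/dy`
on `(0, L)`, `s ≥ 0`, and suppose the integrated second-derivative inequality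
`g'(y) ≥ g'(0) + s ∫₀ʸ ρ g` on `[0, L)`. Then `g` satisfies the integral supersolution
inequality `1 + s ∫_{[0,y]} (y - t) g(t) ρ(t) dt ≤ g(y)` on `[0, L)`.

Proof. Fix `y ∈ [0, L)`. By FTC-2, `g(y) = g(0) + ∫₀ʸ g'`. Monotonicity of the interval
integral and `g'(0) ≥ 0` give `∫₀ʸ g' ≥ ∫₀ʸ s F`, `F(t) = ∫₀ᵗ ρ g`. Integration by parts with
`u(t) = y - t`, `v = F` (`F' = ρ g` on `(0, y)` by FTC-1, `F(0) = 0`) gives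
`∫₀ʸ F = ∫₀ʸ (y - t) ρ(t) g(t) dt`, and the interval integral over `0..y` is the Bochner
integral over `[0, y]`.
-/

noncomputable section

set_option linter.dupNamespace false

open MeasureTheory Filter Topology Set

namespace Summit.RiemannHypothesis.RiemannHypothesis.Theorems.LeeYangTelegraphString

/-- Second-antiderivative identity (integration by parts): for `f` continuous on `[0, L)` and
`0 ≤ y < L`, `∫₀ʸ (∫₀ᵗ f) dt = ∫₀ʸ (y - t) f(t) dt`. -/
theorem integral_primitive_eq_integral_sub_mul (f : ℝ → ℝ) {y L : ℝ} (h0y : 0 ≤ y)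
    (hyL : y < L) (hf : ContinuousOn f (Ico 0 L)) :
    ∫ t in (0 : ℝ)..y, (∫ τ in (0 : ℝ)..t, f τ) = ∫ t in (0 : ℝ)..y, (y - t) * f t := by
  have hsub : Icc 0 y ⊆ Ico 0 L := fun t ht => ⟨ht.1, ht.2.trans_lt hyL⟩
  have huIcc : uIcc 0 y = Icc 0 y := uIcc_of_le h0y
  have hfi : IntervalIntegrable f volume 0 y := (hf.mono hsub).intervalIntegrable_of_Icc h0y
  have hFc : ContinuousOn (fun t => ∫ τ in (0 : ℝ)..t, f τ) (uIcc 0 y) :=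
    intervalIntegral.continuousOn_primitive_interval
      (by rw [huIcc]; exact (hf.mono hsub).integrableOn_Icc)
  have hderF : ∀ t ∈ Ioo (min 0 y) (max 0 y),
      HasDerivAt (fun u => ∫ τ in (0 : ℝ)..u, f τ) (f t) t := by
    intro t ht
    rw [min_eq_left h0y, max_eq_right h0y] at ht
    have htL : t ∈ Ioo 0 L := ⟨ht.1, ht.2.trans hyL⟩
    have hnhds : Ico 0 L ∈ 𝓝 t := mem_of_superset (Ioo_mem_nhds htL.1 htL.2) Ioo_subset_Ico_self
    refine intervalIntegral.integral_hasDerivAt_right ?_ ?_ (hf.continuousAt hnhds)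
    · exact (hf.mono ((Icc_subset_Icc_right ht.2.le).trans hsub)).intervalIntegrable_of_Icc
        ht.1.le
    · exact (hf.mono Ioo_subset_Ico_self).stronglyMeasurableAtFilter isOpen_Ioo t htL
  have hu : ∀ t ∈ Ioo (min 0 y) (max 0 y), HasDerivAt (fun u : ℝ => y - u) (-1) t :=
    fun t _ => (hasDerivAt_id' t).const_sub y
  have hparts := intervalIntegral.integral_mul_deriv_eq_deriv_mul_of_hasDerivAt
    (u := fun u : ℝ => y - u) (u' := fun _ => (-1 : ℝ)) (v := fun t => ∫ τ in (0 : ℝ)..t, f τ)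
    (v' := f) (continuousOn_const.sub continuousOn_id) hFc hu hderF intervalIntegrable_const hfi
  rw [hparts]
  simp [intervalIntegral.integral_same]

/-- Taylor-type passage from an integrated second-derivative inequality to the integral
supersolution inequality used by `phi_neg_re_le_of_supersolution`: if `g` is `C¹` on `[0, L)` with
`g(0) ≥ 1`, `g'(0) ≥ 0`, `g ≥ 0` and `g'(y) ≥ g'(0) + s ∫₀ʸ ρ g`, then
`1 + s ∫_{[0,y]} (y - t) g(t) ρ(t) dt ≤ g(y)` for `y ∈ [0, L)`. -/
theorem stub_taylorSuper : ∀ (L s : ℝ) (ρ g g' : ℝ → ℝ), 0 ≤ s →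
    ContinuousOn ρ (Set.Ico 0 L) → (∀ y ∈ Set.Ico 0 L, 0 ≤ ρ y) →
    ContinuousOn g (Set.Ico 0 L) → ContinuousOn g' (Set.Ico 0 L) →
    (∀ y ∈ Set.Ioo 0 L, HasDerivAt g (g' y) y) → 1 ≤ g 0 → 0 ≤ g' 0 →
    (∀ y ∈ Set.Ico 0 L, 0 ≤ g y) →
    (∀ y ∈ Set.Ico 0 L, g' 0 + s * ∫ t in (0 : ℝ)..y, ρ t * g t ≤ g' y) →
    ∀ y ∈ Set.Ico 0 L, 1 + s * ∫ t in Set.Icc 0 y, (y - t) * g t * ρ t ≤ g y := by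
  intro L s ρ g g' _hs hρc _hρ0 hgc hg'c hder hg0 hg'0 _hgnn hineq y hy
  obtain ⟨h0y, hyL⟩ := hy
  have hsub : Icc 0 y ⊆ Ico 0 L := fun t ht => ⟨ht.1, ht.2.trans_lt hyL⟩
  have huIcc : uIcc 0 y = Icc 0 y := uIcc_of_le h0y
  have hfc : ContinuousOn (fun t => ρ t * g t) (Ico 0 L) := hρc.mul hgc
  have hg'i : IntervalIntegrable g' volume 0 y := (hg'c.mono hsub).intervalIntegrable_of_Icc h0y
  -- FTC-2 for `g` on `[0, y]`
  have hftc : ∫ t in (0 : ℝ)..y, g' t = g y - g 0 :=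
    intervalIntegral.integral_eq_sub_of_hasDerivAt_of_le h0y (hgc.mono hsub)
      (fun t ht => hder t ⟨ht.1, ht.2.trans hyL⟩) hg'i
  -- the primitive `F(t) = ∫₀ᵗ ρ g` is continuous, hence interval integrable, on `[0, y]`
  set F : ℝ → ℝ := fun t => ∫ τ in (0 : ℝ)..t, ρ τ * g τ with hF
  have hFc : ContinuousOn F (uIcc 0 y) :=
    intervalIntegral.continuousOn_primitive_interval
      (by rw [huIcc]; exact (hfc.mono hsub).integrableOn_Icc)
  have hFi : IntervalIntegrable F volume 0 y := by
    rw [huIcc] at hFc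
    exact hFc.intervalIntegrable_of_Icc h0y
  -- monotonicity of the interval integral (drop `y * g'(0) ≥ 0`)
  have hmono : ∫ t in (0 : ℝ)..y, s * F t ≤ ∫ t in (0 : ℝ)..y, g' t := by
    refine intervalIntegral.integral_mono_on h0y (hFi.const_mul s) hg'i fun t ht => ?_
    have := hineq t (hsub ht)
    linarith
  -- integration by parts: `∫₀ʸ F = ∫₀ʸ (y - t) ρ(t) g(t) dt`
  have hparts : ∫ t in (0 : ℝ)..y, F t = ∫ t in (0 : ℝ)..y, (y - t) * (ρ t * g t) :=
    integral_primitive_eq_integral_sub_mul (fun t => ρ t * g t) h0y hyL hfc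
  -- the Bochner integral over `[0, y]` is the interval integral over `0..y`
  have hconv : ∫ t in Icc 0 y, (y - t) * g t * ρ t = ∫ t in (0 : ℝ)..y, (y - t) * (ρ t * g t) := by
    rw [integral_Icc_eq_integral_Ioc, ← intervalIntegral.integral_of_le h0y]
    refine intervalIntegral.integral_congr fun t _ => ?_
    ring
  calc 1 + s * ∫ t in Icc 0 y, (y - t) * g t * ρ t = 1 + ∫ t in (0 : ℝ)..y, s * F t := by
        rw [hconv, ← hparts, intervalIntegral.integral_const_mul]
    _ ≤ g 0 + ∫ t in (0 : ℝ)..y, g' t := add_le_add hg0 hmono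
    _ = g y := by rw [hftc]; ring

end Summit.RiemannHypothesis.RiemannHypothesis.Theorems.LeeYangTelegraphString
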